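import Literature.Topology.Algebra.ProfiniteAutCongruenceCompact
import HarnessLib

/-!
# The congruence topology, III: `Out(G)` of a topologically finitely generated profinite group is
# profinite

Dixon–du Sautoy–Mann–Segal, *Analytic pro-`p` groups* (2nd ed., 1999), §5.2 Theorem 5.3 (`Aut(G)`
profinite) [cite: DixonEtAl1999, §5.2 Thm 5.3], and its immediate corollary for
`Out(G) = Aut(G)/Inn(G)` (the inner automorphisms are the continuous image of the compact `G`, hence
a closed normal subgroup) — the form in which Mochizuki, [SemiAnbd] Def. 2.3 (iii) p. 25 uses it:
"`π̂₁(G_c)` topologically finitely generated … implies that `Out(π̂₁(G_c))` is equipped with a natural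
profinite group structure" (and Def. 5.1 (i)(c) p. 62, the continuity of `H → Out(π̂₁(G_v))`).

Over parts I–II (`ProfiniteAutCongruence*.lean`):
* `innerHom G : G →* CongrAut G`, `g ↦ (x ↦ g x g⁻¹)`, CONTINUOUS for the congruence topology
  (`continuous_innerHom`: the level of `Inn(g)` only depends on `g mod charCore G n`);
* `innerCongr G` — its range, equal to the tree's `innerContAut G` (`innerCongr_eq_innerContAut`),
  normal and CLOSED (`isClosed_innerCongr`);
* `CongrOut G := CongrAut G ⧸ innerCongr G` with the quotient topology: compact, Hausdorff, totally
  disconnected — bundled `congrOutProfinite hG : ProfiniteGrp`, with `CongrOut G ≃* TopOut G`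
  (`CongrOut.equivTopOut`, the tree's abstract outer automorphism group of a topological group).

Mathlib-level; elementary; no side is taken on anything disputed.
-/

namespace Literature.Topology.Algebra

open _root_.Topology Literature.AnabelianGeometry.AbsoluteAnabelian
open Literature.AnabelianGeometry.EtaleTheta (contMulAut mem_contMulAut innerAut innerContAut TopOut
  innerAut_le_contMulAut)

universe u

variable {G : Type u} [Group G] [TopologicalSpace G] [IsTopologicalGroup G]

/-! ## Inner automorphisms in the congruence topology -/

variable (G) in
/-- The inner automorphism `g ↦ (x ↦ g x g⁻¹)` as an element of `Aut_top(G)` (congruence topology).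
[cite: DixonEtAl1999, §5.2 Thm 5.3] -/
def innerHom : G →* CongrAut G where
  toFun g := (⟨MulAut.conj g, innerAut_le_contMulAut G ⟨g, rfl⟩⟩ : contMulAut G)
  map_one' := Subtype.ext (map_one MulAut.conj)
  map_mul' g h := Subtype.ext (map_mul MulAut.conj g h)

/-- The underlying automorphism of `innerHom G g` is conjugation by `g`.
[cite: DixonEtAl1999, §5.2 Thm 5.3] -/
@[simp] theorem innerHom_val (g : G) :
    ((CongrAut.equivContMulAut G (innerHom G g) : contMulAut G) : MulAut G) = MulAut.conj g := rfl

/-- The level of an inner automorphism only depends on the class modulo `charCore G n`.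
[cite: DixonEtAl1999, §5.2 Thm 5.3] -/
theorem levelMap_innerHom_eq_of_mem {n : ℕ} {g v : G} (hv : v ∈ charCore G n) :
    CongrAut.levelMap G (innerHom G (g * v)) n = CongrAut.levelMap G (innerHom G g) n := by
  apply (LevelAut.equivMulAut (G := G) n).injective
  apply MulEquiv.ext
  intro q
  induction q using QuotientGroup.induction_on with
  | H x =>
    change LevelAut.equivMulAut n (levelHom G n (CongrAut.equivContMulAut G (innerHom G (g * v)))) _ =
      LevelAut.equivMulAut n (levelHom G n (CongrAut.equivContMulAut G (innerHom G g))) _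
    rw [levelHom_mk, levelHom_mk, innerHom_val, innerHom_val, MulAut.conj_apply, MulAut.conj_apply,
      QuotientGroup.eq]
    have h1 : (g * v * x * (g * v)⁻¹)⁻¹ * (g * x * g⁻¹) = g * (v * (x⁻¹ * v⁻¹ * x⁻¹⁻¹)) * g⁻¹ := by
      group
    rw [h1]
    exact (charCore_normal n).conj_mem _
      (mul_mem hv ((charCore_normal n).conj_mem v⁻¹ (inv_mem hv) x⁻¹)) g

/-- **`Inn : G → Aut(G)` is continuous** for the congruence topology (`G` compact, topologically
finitely generated). [cite: DixonEtAl1999, §5.2 Thm 5.3] -/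
theorem continuous_innerHom [CompactSpace G] [TotallyDisconnectedSpace G]
    (hG : IsTopologicallyFinitelyGenerated G) : Continuous (innerHom G) := by
  rw [(CongrAut.isInducing_levelMap G).continuous_iff]
  apply continuous_pi
  intro n
  refine (IsLocallyConstant.iff_exists_open _).mpr (fun g => ?_) |>.continuous
  refine ⟨(fun g' => g⁻¹ * g') ⁻¹' (charCore G n : Set G), ?_, ?_, ?_⟩
  · exact (isOpen_charCore hG n).preimage (by fun_prop)
  · simp
  · intro g' hg'
    have h : g' = g * (g⁻¹ * g') := by group
    change CongrAut.levelMap G (innerHom G g') n = CongrAut.levelMap G (innerHom G g) n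
    rw [h]
    exact levelMap_innerHom_eq_of_mem hg'

/-! ## The closed normal subgroup of inner automorphisms -/

variable (G) in
/-- `Inn(G) ≤ Aut_top(G)` in the congruence topology: the tree's `innerContAut G` carried to the
synonym `CongrAut G`. [cite: DixonEtAl1999, §5.2 Thm 5.3] -/
def innerCongr : Subgroup (CongrAut G) := (innerContAut G).map (CongrAut.equivContMulAut G).symm

/-- `innerCongr G` is the range of `innerHom G`. [cite: DixonEtAl1999, §5.2 Thm 5.3] -/
theorem range_innerHom : (innerHom G).range = innerCongr G := by
  ext φ
  constructor
  · rintro ⟨g, rfl⟩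
    refine ⟨CongrAut.equivContMulAut G (innerHom G g), ?_, by simp⟩
    change ((CongrAut.equivContMulAut G (innerHom G g) : contMulAut G) : MulAut G) ∈ innerAut G
    exact ⟨g, rfl⟩
  · rintro ⟨ψ, hψ, rfl⟩
    obtain ⟨g, hg⟩ : ((ψ : contMulAut G) : MulAut G) ∈ innerAut G := hψ
    refine ⟨g, ?_⟩
    apply (CongrAut.equivContMulAut G).injective
    apply Subtype.ext
    simpa using hg

/-- `innerCongr G` is normal. [cite: DixonEtAl1999, §5.2 Thm 5.3] -/
instance innerCongr_normal : (innerCongr G).Normal := by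
  rw [← range_innerHom]
  refine ⟨fun φ ⟨g, hg⟩ ψ => ?_⟩
  subst hg
  refine ⟨(CongrAut.equivContMulAut G ψ : contMulAut G).1 g, ?_⟩
  apply (CongrAut.equivContMulAut G).injective
  apply Subtype.ext
  apply MulEquiv.ext
  intro x
  change MulAut.conj ((CongrAut.equivContMulAut G ψ : contMulAut G).1 g) x =
    (CongrAut.equivContMulAut G ψ : contMulAut G).1
      (MulAut.conj g (((CongrAut.equivContMulAut G ψ : contMulAut G).1)⁻¹ x))
  rw [MulAut.conj_apply, MulAut.conj_apply, map_mul, map_mul, MulAut.apply_inv_self, map_inv]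

/-- `Inn(G)` is closed in the congruence topology (continuous image of the compact `G` in a Hausdorff
group). [cite: DixonEtAl1999, §5.2 Thm 5.3] -/
theorem isClosed_innerCongr [CompactSpace G] [TotallyDisconnectedSpace G]
    (hG : IsTopologicallyFinitelyGenerated G) : IsClosed (innerCongr G : Set (CongrAut G)) := by
  rw [← range_innerHom, MonoidHom.coe_range]
  exact (isCompact_range (continuous_innerHom hG)).isClosed

/-! ## `Out(G)` -/

variable (G) in
/-- `Out_top(G) := Aut_top(G) ⧸ Inn(G)` with the quotient of the congruence topology.
[cite: DixonEtAl1999, §5.2 Thm 5.3] -/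
def CongrOut : Type u := CongrAut G ⧸ innerCongr G

/-- The group structure of `Out_top(G)` (quotient group). [cite: DixonEtAl1999, §5.2 Thm 5.3] -/
instance : Group (CongrOut G) := inferInstanceAs (Group (CongrAut G ⧸ innerCongr G))

/-- The quotient topology on `Out_top(G)`. [cite: DixonEtAl1999, §5.2 Thm 5.3] -/
instance : TopologicalSpace (CongrOut G) :=
  inferInstanceAs (TopologicalSpace (CongrAut G ⧸ innerCongr G))

/-- `Out_top(G)` is a topological group. [cite: DixonEtAl1999, §5.2 Thm 5.3] -/
instance : IsTopologicalGroup (CongrOut G) :=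
  inferInstanceAs (IsTopologicalGroup (CongrAut G ⧸ innerCongr G))

variable (G) in
/-- The projection `Aut_top(G) → Out_top(G)`. [cite: DixonEtAl1999, §5.2 Thm 5.3] -/
def CongrOut.mk : CongrAut G →* CongrOut G := QuotientGroup.mk' (innerCongr G)

/-- The projection is continuous. [cite: DixonEtAl1999, §5.2 Thm 5.3] -/
theorem CongrOut.continuous_mk : Continuous (CongrOut.mk G) :=
  QuotientGroup.continuous_mk (N := innerCongr G)

/-- The projection is surjective. [cite: DixonEtAl1999, §5.2 Thm 5.3] -/
theorem CongrOut.mk_surjective : Function.Surjective (CongrOut.mk G) :=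
  QuotientGroup.mk'_surjective _

/-- `Out_top(G)` is, as an abstract group, the tree's `TopOut G = contMulAut G ⧸ innerContAut G`.
[cite: DixonEtAl1999, §5.2 Thm 5.3] -/
noncomputable def CongrOut.equivTopOut : CongrOut G ≃* TopOut G :=
  QuotientGroup.congr (innerCongr G) (innerContAut G) (CongrAut.equivContMulAut G) (by
    rw [innerCongr, Subgroup.map_map]
    have h : ((CongrAut.equivContMulAut G : CongrAut G ≃* contMulAut G) : CongrAut G →* contMulAut G).comp
        ((CongrAut.equivContMulAut G).symm : contMulAut G →* CongrAut G) = MonoidHom.id _ :=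
      MonoidHom.ext fun _ => rfl
    rw [h, Subgroup.map_id])

section Profinite

variable [CompactSpace G] [TotallyDisconnectedSpace G] (hG : IsTopologicallyFinitelyGenerated G)

include hG in
/-- `Out_top(G)` is compact. [cite: DixonEtAl1999, §5.2 Thm 5.3] -/
theorem compactSpace_congrOut : CompactSpace (CongrOut G) := by
  haveI := compactSpace_congrAut hG
  exact inferInstanceAs (CompactSpace (CongrAut G ⧸ innerCongr G))

include hG in
/-- `Out_top(G)` is Hausdorff (`Inn(G)` is closed). [cite: DixonEtAl1999, §5.2 Thm 5.3] -/
theorem t2Space_congrOut : T2Space (CongrOut G) := by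
  haveI : IsClosed (innerCongr G : Set (CongrAut G)) := isClosed_innerCongr hG
  haveI : T3Space (CongrAut G ⧸ innerCongr G) := QuotientGroup.instT3Space (innerCongr G)
  exact inferInstanceAs (T2Space (CongrAut G ⧸ innerCongr G))

include hG in
/-- `Out_top(G)` is totally disconnected (quotient of a profinite group by a closed normal subgroup;
the tree's `QuotientGroup.totallyDisconnectedSpace_of_isClosed`). [cite: DixonEtAl1999, §5.2 Thm 5.3] -/
theorem totallyDisconnectedSpace_congrOut : TotallyDisconnectedSpace (CongrOut G) := by
  haveI := compactSpace_congrAut hG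
  exact QuotientGroup.totallyDisconnectedSpace_of_isClosed (innerCongr G) (isClosed_innerCongr hG)

/-- **`Out(G)` of a topologically finitely generated profinite group, as a PROFINITE GROUP** (the
"natural profinite group structure" of [SemiAnbd] Def. 2.3 (iii)). [cite: DixonEtAl1999, §5.2 Thm 5.3] -/
noncomputable def congrOutProfinite : ProfiniteGrp.{u} :=
  letI : CompactSpace (CongrOut G) := compactSpace_congrOut hG
  letI : TotallyDisconnectedSpace (CongrOut G) := totallyDisconnectedSpace_congrOut hG
  ProfiniteGrp.of (CongrOut G)

/-- The underlying group of `congrOutProfinite hG` is the tree's `TopOut G`.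
[cite: DixonEtAl1999, §5.2 Thm 5.3] -/
noncomputable def congrOutProfiniteEquiv : congrOutProfinite hG ≃* TopOut G := CongrOut.equivTopOut

end Profinite

end Literature.Topology.Algebra
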